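import Literature.AlgebraicGeometry.HodgeTheory.HodgeClassesBlowupBirationalInvarianceProofs
import Literature.AlgebraicGeometry.HodgeTheory.CorrespondenceSupportedVanishing
import Literature.AlgebraicGeometry.Resolution.ProjectiveResolutionProofs
import Literature.AlgebraicGeometry.Resolution.ChowLemmaProofs
import Literature.AlgebraicGeometry.Resolution.BaseChangeOverOpens
import Literature.AlgebraicGeometry.Resolution.ComponentGluing
import Literature.AlgebraicGeometry.Resolution.BirationalDimensionInequality
import Mathlib.AlgebraicGeometry.Birational.Birational
import HarnessLib

/-!
# A smooth projective ROOF over a birational equivalence: birational smooth projective `n`-folds `X ~ X'` (Mathlib's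
# `Scheme.BirationalOver`, a partial isomorphism over `ℂ`) are joined by birational MORPHISMS `X ← X'' → X'` from a smooth
# projective `n`-fold `X''` — resolve the closure of the graph (Hartshorne II Ex. 7.17.3, V Remark 5.6.1; Hironaka)

[topic AlgebraicGeometry/HodgeTheory]

Layer `Literature/AlgebraicGeometry/HodgeTheory` (next to its consumer predicate `HaveCommonSmoothModel` of
`HodgeClassesBlowupBirationalInvariance`). THEOREMS ONLY (no definition, no named fact, no instance, no notation). Written for the cell
`hodge-nonav` (prover seat `hodge-nonav-prover-Bx` g20; programme M2 = stub S2 of crux K1Q, route `Q8SymplecticPowers`, whose leaf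
quantifies over ALL smooth projective surfaces birational over `ℂ` — `AlgebraicGeometry.Scheme.BirationalOver` — to a singular quartic model),
route-agnostic. All inputs are THEOREMS of the tree and of Mathlib:

* the graph `Γ_e : U → X ×_ℂ X'` of the partial isomorphism `e : U ⥲ V` and its scheme-theoretic image `Γ` (Mathlib `Scheme.Hom.image`;
  integral by `ChowLemmaProof.isIntegral_image`, projective as a closed subscheme of the Segre product `IsProjectiveOver.tensor`);
* both projections `Γ → X`, `Γ → X'` are birational: `U → Γ` (resp. `V ≅ U → Γ`) is a dominant SECTION over the dense open `U`
  (resp. `V`) of a separated morphism to a reduced scheme, hence the projection is an isomorphism over it with dense preimage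
  (`ChowLemmaProof.isIso_morphismRestrict_of_section`, the device of `DeJong1996.isBirational_graphClosureFst`);
* Hironaka's projective resolution `X'' → Γ` (`Resolution.exists_isSmoothProjective_isBirational_of_isProjectiveOver`, Kollár 2007
  Thm. 3.27), of dimension `dim Γ = dim X = n` (`IsBirational.topologicalKrullDim_eq_of_isProper`), and composition of birational
  morphisms (`IsBirational.comp`).

## The sources, verbatim

* R. Hartshorne, *Algebraic Geometry* (1977), II Example 7.17.3 (elimination of indeterminacy by blowing up) and V Remark 5.6.1
  «the birational map `T' = T ∘ f` is a morphism» (after Hironaka 1964); V Thm. 5.5 (surfaces).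
* J. Kollár, *Lectures on Resolution of Singularities* (2007), Thm. 3.27 (projective resolution), Cor. 3.18.
* D. Arapura, *Motivation for Hodge cycles* (2006), Cor. 17: «if `X` and `X'` are two birational smooth projective varieties» (a roof
  exists by resolving the graph).

## What is proved

* §1 **`exists_isSmoothProjective_roof_of_birationalOver`** — for smooth projective complex `n`-folds `X`, `X'` with
  `Scheme.BirationalOver X.hom X'.hom`: `∃ X'' (p : X'' ⟶ X) (q : X'' ⟶ X'), IsSmoothProjective n X'' ∧ IsBirational p.left ∧ IsBirational q.left`.
* §2 **`haveCommonSmoothModel_of_birationalOver`** — hence `HaveCommonSmoothModel n X X'` (the tree's roof predicate, with the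
  surjectivity of the legs from `haveCommonSmoothModel_of_isBirational`).

Honest scope: algebraic geometry of the tree; nothing here concerns cohomology or the Hodge conjecture.
-/

noncomputable section

open CategoryTheory CategoryTheory.Limits AlgebraicGeometry MonoidalCategory CartesianMonoidalCategory TopologicalSpace
  Literature.AlgebraicGeometry Literature.AlgebraicGeometry.Motives Literature.AlgebraicGeometry.Resolution

namespace Literature.AlgebraicGeometry.HodgeTheory

/-! ## §1 The roof -/

/-- **Resolving the graph of a birational map.** Let `X`, `X'` be smooth projective complex `n`-folds and `e : U ⥲ V` a partial
isomorphism over `ℂ` between dense opens `U ⊆ X`, `V ⊆ X'` (Mathlib `Scheme.BirationalOver X.hom X'.hom`). The scheme-theoretic image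
`Γ ⊆ X ×_ℂ X'` of the graph of `e` is an integral projective variety whose projections to `X` and `X'` are birational (isomorphisms over
`U` and `V`, by the section trick); a projective resolution `X'' → Γ` (Hironaka) is smooth projective of dimension `dim Γ = dim X = n`, and
the composites `X'' → X`, `X'' → X'` are birational morphisms. [cite: Hartshorne1977, II Example 7.17.3 and V Remark 5.6.1]
[cite: Kollar2007, Thm. 3.27 and Cor. 3.18] [cite: Arapura2001HodgeCyclesModuli, Cor. 17] -/
theorem exists_isSmoothProjective_roof_of_birationalOver {n : ℕ} {X X' : SchemeOver ℂ} (hX : IsSmoothProjective n X)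
    (hX' : IsSmoothProjective n X') (h : Scheme.BirationalOver X.hom X'.hom) :
    ∃ (X'' : SchemeOver ℂ) (p : X'' ⟶ X) (q : X'' ⟶ X'),
      IsSmoothProjective n X'' ∧ IsBirational p.left ∧ IsBirational q.left := by
  classical
  obtain ⟨f, hf⟩ := h
  haveI : IsIntegral X.left := IsSmoothProjective.isIntegral_holds hX
  haveI : IsIntegral X'.left := IsSmoothProjective.isIntegral_holds hX'
  haveI : NoetherianSpace X.left := noetherianSpace_of_isSmoothProjective hX
  haveI : IsLocallyNoetherian X.left := IsSmoothProjective.isLocallyNoetherian_holds hX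
  haveI : IsProper X.hom := hX.isProjectiveOver.isProper
  haveI : IsProper X'.hom := hX'.isProjectiveOver.isProper
  haveI := hX.smoothOfRelativeDimension
  -- the dense open `U = source` is a non-empty integral Noetherian scheme
  have hUne : ((f.source : X.left.Opens) : Set X.left).Nonempty := f.dense_source.nonempty
  haveI : Nonempty (f.source : Scheme) := ⟨⟨_, hUne.some_mem⟩⟩
  haveI : IsIntegral (f.source : Scheme) := isIntegral_of_isOpenImmersion f.source.ι
  haveI : NoetherianSpace (f.source : Scheme) := (noetherianSpace_set_iff _).mpr fun s _ => NoetherianSpace.isCompact s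
  -- the graph `γ : U → X ×_ℂ X'` of `e = f.iso`
  let γ : (f.source : Scheme) ⟶ pullback X.hom X'.hom :=
    pullback.lift f.source.ι (f.iso.hom ≫ f.target.ι) (by rw [Category.assoc]; exact (Eq.symm hf))
  have hγ1 : γ ≫ pullback.fst X.hom X'.hom = f.source.ι := pullback.lift_fst _ _ _
  have hγ2 : γ ≫ pullback.snd X.hom X'.hom = f.iso.hom ≫ f.target.ι := pullback.lift_snd _ _ _
  -- its scheme-theoretic image `Γ`, integral and projective over `ℂ`
  haveI : QuasiCompact γ := inferInstance
  haveI hΓint : IsIntegral γ.image := ChowLemmaProof.isIntegral_image γ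
  let Γo : SchemeOver ℂ := Over.mk (γ.imageι ≫ (X ⊗ X').hom)
  let ιΓ : Γo ⟶ X ⊗ X' := Over.homMk γ.imageι rfl
  haveI : IsClosedImmersion ιΓ.left := inferInstanceAs (IsClosedImmersion γ.imageι)
  have hΓproj : IsProjectiveOver Γo :=
    isProjectiveOver_of_isClosedImmersion_left ιΓ (hX.isProjectiveOver.tensor hX'.isProjectiveOver)
  haveI : IsIntegral Γo.left := hΓint
  -- the two projections
  let p₀ : Γo ⟶ X := Over.homMk (γ.imageι ≫ pullback.fst X.hom X'.hom) rfl
  let q₀ : Γo ⟶ X' := Over.homMk (γ.imageι ≫ pullback.snd X.hom X'.hom) (by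
    change (γ.imageι ≫ pullback.snd X.hom X'.hom) ≫ X'.hom = γ.imageι ≫ pullback.fst X.hom X'.hom ≫ X.hom
    rw [Category.assoc, ← pullback.condition])
  have hp₀ : p₀.left = γ.imageι ≫ pullback.fst X.hom X'.hom := rfl
  have hq₀ : q₀.left = γ.imageι ≫ pullback.snd X.hom X'.hom := rfl
  haveI : IsSeparated (γ.imageι ≫ pullback.fst X.hom X'.hom) := inferInstance
  haveI : IsSeparated (γ.imageι ≫ pullback.snd X.hom X'.hom) := inferInstance
  haveI : IsProper (γ.imageι ≫ pullback.fst X.hom X'.hom) := inferInstance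
  -- `p₀` is an isomorphism over `U`: `U → Γ` is a dominant section
  have hs₁ : γ.toImage ≫ (γ.imageι ≫ pullback.fst X.hom X'.hom) = f.source.ι := by
    rw [Scheme.Hom.toImage_imageι_assoc, hγ1]
  obtain ⟨hiso₁, hdense₁⟩ := ChowLemmaProof.isIso_morphismRestrict_of_section (γ.imageι ≫ pullback.fst X.hom X'.hom)
    f.source γ.toImage hs₁
  have hbir₁ : IsBirational p₀.left := ⟨f.source, f.dense_source, hdense₁, hiso₁⟩
  -- `q₀` is an isomorphism over `V`: `V ≅ U → Γ` is a dominant section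
  have hs₂ : (f.iso.inv ≫ γ.toImage) ≫ (γ.imageι ≫ pullback.snd X.hom X'.hom) = f.target.ι := by
    rw [Category.assoc, Scheme.Hom.toImage_imageι_assoc, hγ2, Iso.inv_hom_id_assoc]
  haveI : IsDominant (f.iso.inv ≫ γ.toImage) := inferInstance
  obtain ⟨hiso₂, hdense₂⟩ := ChowLemmaProof.isIso_morphismRestrict_of_section (γ.imageι ≫ pullback.snd X.hom X'.hom)
    f.target (f.iso.inv ≫ γ.toImage) hs₂
  have hbir₂ : IsBirational q₀.left := ⟨f.target, f.dense_target, hdense₂, hiso₂⟩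
  -- Hironaka: a smooth projective resolution `π : X'' → Γ`, of dimension `d = dim Γ`
  obtain ⟨d, Y, π, hY, hπ, hd⟩ := exists_isSmoothProjective_isBirational_of_isProjectiveOver Γo hΓproj
  -- `d = n`: `dim Γ = dim X = n` along the proper birational `p₀`
  have hdn : d = n := by
    haveI : IsProper p₀.left := ‹IsProper (γ.imageι ≫ pullback.fst X.hom X'.hom)›
    have h1 : topologicalKrullDim Γo.left = topologicalKrullDim X.left := hbir₁.topologicalKrullDim_eq_of_isProper
    have h2 : topologicalKrullDim X.left = n := topologicalKrullDim_eq_of_smoothOfRelativeDimension (f := X.hom) (n := n)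
    have h3 := Motives.Scheme.height_genericPoint Γo.left
    rw [hd, h1, h2] at h3
    exact_mod_cast h3
  subst hdn
  exact ⟨Y, π ≫ p₀, π ≫ q₀, hY, hπ.comp hbir₁, hπ.comp hbir₂⟩

/-! ## §2 The common smooth model -/

/-- **Birational smooth projective `n`-folds have a common smooth model** (`HaveCommonSmoothModel n X X'`: a roof with birational
surjective legs) as soon as they are birational over `ℂ` in Mathlib's sense (`Scheme.BirationalOver`). [cite: Arapura2001HodgeCyclesModuli, Cor. 17]
[cite: Hartshorne1977, V Remark 5.6.1] -/
theorem haveCommonSmoothModel_of_birationalOver {n : ℕ} {X X' : SchemeOver ℂ} (hX : IsSmoothProjective n X)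
    (hX' : IsSmoothProjective n X') (h : Scheme.BirationalOver X.hom X'.hom) : HaveCommonSmoothModel n X X' := by
  obtain ⟨X'', p, q, hX'', hp, hq⟩ := exists_isSmoothProjective_roof_of_birationalOver hX hX' h
  exact haveCommonSmoothModel_of_isBirational hX hX' hX'' p q hp hq

end Literature.AlgebraicGeometry.HodgeTheory

end
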